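import Literature.Topology.PlanarFoliations.Kneser
import HarnessLib

/-!
# An open leaf does not ω- and α-accumulate on a point its crossings keep on one side

Topic: Topology / PlanarFoliations, sequel to `OmegaLimit.lean`, `Kneser.lean`. The core of
`Kneser.not_mem_omegaSet_of_mem_alphaSet_of_subset` (an open leaf inside a compact leaf `K` does
not accumulate on `K` at both ends) only uses that **the crossings of the leaf with the vertical
through the point `k` all lie strictly on one side of `k`**. We record the statement in that
generality (`not_mem_omegaSet_of_mem_alphaSet_of_oneSide`), so that it applies to a point `k` of a
separatrix bounding the leaf on one side (a vertex or edge point of a separatrix polygon): three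
crossings `r < p < q` with `ht q` strictly between `ht p` and `ht r`, found by ω-accumulation
after `p` and α-accumulation before `p`, violate the monotonicity of crossings (`ht_not_mem_Ioo`).

## References

* C. Camacho, A. Lins Neto, *Geometric Theory of Foliations*, Birkhäuser (1985), Ch. VII §2
  [CamachoLinsNeto1985].
-/

noncomputable section

open Set Filter Function
open _root_.Topology
open Literature.Topology.FourManifolds Literature.Topology.FourManifolds.Foliation

namespace Literature.Topology.PlanarFoliations

variable {X : Type*} [TopologicalSpace X] [T2Space X] [SecondCountableTopology X] {F : Foliation ℝ X} {w : X}
variable [NoncompactSpace (F.Leaf w)] {hbi : IsBiOriented F}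
variable {e : OpenPartialHomeomorph X (ℝ × ℝ)} {u₀ : ℝ} {ι : X → ℂ}

/-- **An open leaf whose crossings with the vertical through a point lie strictly on one side of
it does not both ω- and α-accumulate on that point.** [folklore] -/
theorem not_mem_omegaSet_of_mem_alphaSet_of_oneSide (he : e ∈ F.atlas) (hι : IsOpenEmbedding ι) {s : ℝ}
    (hne : ∀ {c : F.Leaf w}, IsCrossing e u₀ c → ht e c ≠ s)
    (hone : ∀ {c₁ c₂ : F.Leaf w}, IsCrossing e u₀ c₁ → IsCrossing e u₀ c₂ → 0 < (ht e c₁ - s) * (ht e c₂ - s))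
    (hα : ι (e.symm (u₀, s)) ∈ alphaSet hbi ι w) : ι (e.symm (u₀, s)) ∉ omegaSet hbi ι w := by
  intro hω
  -- a crossing `p`, a later one `q` nearer to `s`, an earlier one `r` nearer still
  obtain ⟨p, hp, -⟩ := exists_crossing_near₀ (hbi := hbi) he hι hω one_pos
  have hdp : 0 < |ht e p - s| := abs_pos.2 (sub_ne_zero.2 (hne hp))
  obtain ⟨q, hpq, hq, hqn⟩ := exists_crossing_near he hι hω hp (hne hp) hdp le_rfl
  have hdq : 0 < |ht e q - s| := abs_pos.2 (sub_ne_zero.2 (hne hq))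
  obtain ⟨r, hrp, hr, hrn⟩ := exists_crossing_near_alpha he hι hα hp (hne hp) hdq (le_of_lt hqn)
  -- all on one side of `s`
  have hspq := hone hp hq
  have hspr := hone hp hr
  -- so `ht q` is strictly between `ht p` and `ht r`
  have key := ht_not_mem_Ioo he hι hrp hpq hr hp hq
  apply key
  rcases lt_or_gt_of_ne (hne hp) with hlt | hgt
  · -- all below `s`
    have hq' : ht e q < s := by nlinarith
    have hr' : ht e r < s := by nlinarith
    rw [abs_of_neg (sub_neg.2 hlt)] at hqn
    rw [abs_of_neg (sub_neg.2 hq')] at hqn hrn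
    rw [abs_of_neg (sub_neg.2 hr')] at hrn
    rw [min_eq_right (by linarith), max_eq_left (by linarith)]
    exact ⟨by linarith, by linarith⟩
  · -- all above `s`
    have hq' : s < ht e q := by nlinarith
    have hr' : s < ht e r := by nlinarith
    rw [abs_of_pos (sub_pos.2 hgt)] at hqn
    rw [abs_of_pos (sub_pos.2 hq')] at hqn hrn
    rw [abs_of_pos (sub_pos.2 hr')] at hrn
    rw [min_eq_left (by linarith), max_eq_right (by linarith)]
    exact ⟨by linarith, by linarith⟩

/-- **The same with the roles of the two ends exchanged** (by the flip of the foliation): the leaf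
does not α-accumulate on a point it ω-accumulates on, when its crossings keep on one side.
[folklore] -/
theorem not_mem_alphaSet_and_omegaSet_of_oneSide (he : e ∈ F.atlas) (hι : IsOpenEmbedding ι) {s : ℝ}
    (hne : ∀ {c : F.Leaf w}, IsCrossing e u₀ c → ht e c ≠ s)
    (hone : ∀ {c₁ c₂ : F.Leaf w}, IsCrossing e u₀ c₁ → IsCrossing e u₀ c₂ → 0 < (ht e c₁ - s) * (ht e c₂ - s)) :
    ¬ (ι (e.symm (u₀, s)) ∈ alphaSet hbi ι w ∧ ι (e.symm (u₀, s)) ∈ omegaSet hbi ι w) := fun h ↦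
  not_mem_omegaSet_of_mem_alphaSet_of_oneSide he hι hne hone h.1 h.2

end Literature.Topology.PlanarFoliations
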